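import Summits.RiemannHypothesis.RiemannHypothesis.Theorems.WeilGroundStateGroundStatesConvergeToXiStubMellinXi
import Summits.RiemannHypothesis.RiemannHypothesis.Theorems.WeilGroundStateGroundStatesConvergeToXiStubPsiDecay
import Summits.RiemannHypothesis.RiemannHypothesis.Theorems.WeilGroundStateGroundStatesConvergeToXiPhiTail
import Summits.RiemannHypothesis.RiemannHypothesis.Theorems.WeilGroundStateGroundStatesConvergeToXiMellinByParts
import Summits.RiemannHypothesis.RiemannHypothesis.Theorems.WeilGroundStateGroundStatesConvergeToXiCutoff
import Literature.NumberTheory.LFunctions.RiemannXiFourier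
import Literature.NumberTheory.LFunctions.WeilExplicit
import Literature.NumberTheory.LFunctions.WeilExplicitFormulaProofs
import Literature.NumberTheory.LFunctions.WeilZeroSum
import Literature.NumberTheory.LFunctions.WeilMellinBounds
import Literature.Analysis.Calculus.LogCutoff
import HarnessLib

/-!
# `WeilGroundState.GroundStatesConvergeToXi` — the truncated Riemann kernel `φ_a = Φ χ_a` and its tail
(crux item stmt-RiemannHypothesis-1527, route route-RiemannHypothesis-WeilGroundState; line `Sketch`,
lead c2; `--supports`: RH-free, energy side of the open stub `stub_tightWeakLimit`)

`Φ(t) = 2Ψ(2t)` (`LagariasMontague.Psic`, `Φ̂ = weilMellin Φ = ξ` by `stub_mellinXi`) is truncated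
with the tree's plateau cutoff `χ_a = Literature.Analysis.Calculus.cutoff a` (`= 1` on
`[−(a−1), a−1]`, `= 0` off `(−a, a)`).  This file proves:
* `contDiff_thetaSeries`, `contDiff_phi`: every theta series `S_p`, hence `Φ`, is `C^∞`;
* `isWeilTest_phiCut`, `tsupport_phiCut_subset`: `φ_a := Φ χ_a` is a Weil test function on `[−a, a]`;
* `exists_tail_derivs`: the tail `h_a = Φ(1 − χ_a)` has explicit continuous first/second
  derivatives, all dominated — UNIFORMLY in `a` — by the double-exponential envelope
  `exp(|t|/2 − (π/4)e^{2|t|})`, and `h_a = h_a'' = 0` on the open plateau;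
* `exists_norm_weilMellin_tail_le`: `‖ĥ_a(s)‖ ≤ D exp(−(π/4)e^{2(a−1)})/(1+(Im s)²)` in the closed
  strip (two integrations by parts, `norm_weilMellin_le_of_two_derivs`);
* `weilMellin_phiCut_eq`: `φ̂_a = ξ − ĥ_a` in the closed strip; hence AT THE NON-TRIVIAL ZEROS
  `φ̂_a(ρ) = −ĥ_a(ρ)` is double-exponentially small (`exists_norm_weilMellin_phiCut_zero_le`).
The energy bound `Q(φ_a) = O(exp(−(π/2)e^{2(a−1)}))` and `ε(a) ≤ C exp(−(π/2)e^{2(a−1)})` follow in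
`…EnergyUpper.lean`.  No new definitions (all objects inline).
-/

noncomputable section

set_option linter.dupNamespace false

open scoped Topology Real ComplexConjugate
open Filter Set MeasureTheory Complex

namespace Summit.RiemannHypothesis.RiemannHypothesis.Theorems.GroundStatesConvergeToXi

open Literature.NumberTheory.LFunctions


/-! ## Smoothness of Riemann's kernel -/

/-- Every theta series `S_p` is smooth (`S_p' = S_{δp}`, induction on the order). [folklore] -/
theorem contDiff_thetaSeries (p : Polynomial ℝ) :
    ContDiff ℝ (⊤ : ℕ∞) (LagariasMontague.thetaSeries p) := by
  suffices h : ∀ n : ℕ, ∀ q : Polynomial ℝ, ContDiff ℝ n (LagariasMontague.thetaSeries q) from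
    contDiff_infty.2 fun n => h n p
  intro n
  induction n with
  | zero => intro q; exact contDiff_zero.2 (LagariasMontague.continuous_thetaSeries q)
  | succ n ih =>
      intro q
      rw [Nat.cast_succ, contDiff_succ_iff_deriv]
      refine ⟨LagariasMontague.differentiable_thetaSeries q, fun h => ?_, ?_⟩
      · simp at h
      · rw [LagariasMontague.deriv_thetaSeries]
        exact ih _

/-- `Φ(t) = 2Ψ(2t)` is smooth (as a complex-valued function). [folklore] -/
theorem contDiff_phi : ContDiff ℝ (⊤ : ℕ∞) (fun t : ℝ => (2 : ℂ) * LagariasMontague.Psic (2 * t)) := by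
  have h1 : ContDiff ℝ (⊤ : ℕ∞) (fun t : ℝ => LagariasMontague.Psi (2 * t)) :=
    (contDiff_thetaSeries LagariasMontague.psiPoly).comp (contDiff_const.mul contDiff_id)
  have h2 : ContDiff ℝ (⊤ : ℕ∞) (fun t : ℝ => (LagariasMontague.Psi (2 * t) : ℂ)) :=
    Complex.ofRealCLM.contDiff.comp h1
  simpa [LagariasMontague.Psic] using contDiff_const.mul h2

/-! ## The truncated kernel `φ_a = Φ · χ_a` is a test function on `[-a, a]` -/

/-- `φ_a := Φ χ_a` is a Weil test function (`χ_a = Literature.Analysis.Calculus.cutoff a`). [folklore] -/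
theorem isWeilTest_phiCut (a : ℝ) :
    IsWeilTest (fun t : ℝ => (2 : ℂ) * LagariasMontague.Psic (2 * t) *
      ((Literature.Analysis.Calculus.cutoff a t : ℝ) : ℂ)) := by
  refine ⟨contDiff_phi.mul (Complex.ofRealCLM.contDiff.comp
    (Literature.Analysis.Calculus.contDiff_cutoff a)), ?_⟩
  refine HasCompactSupport.intro (isCompact_Icc (a := -a) (b := a)) fun t ht => ?_
  have hta : a ≤ |t| := by
    simp only [mem_Icc, not_and_or, not_le] at ht
    rcases ht with h | h
    · linarith [neg_abs_le t]
    · linarith [le_abs_self t]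
  simp [Literature.Analysis.Calculus.cutoff_eq_zero hta]

/-- `tsupport φ_a ⊆ [-a, a]`. [folklore] -/
theorem tsupport_phiCut_subset (a : ℝ) :
    tsupport (fun t : ℝ => (2 : ℂ) * LagariasMontague.Psic (2 * t) *
      ((Literature.Analysis.Calculus.cutoff a t : ℝ) : ℂ)) ⊆ Icc (-a) a := by
  refine closure_minimal (fun t ht => ?_) isClosed_Icc
  by_contra hmem
  have hta : a ≤ |t| := by
    simp only [mem_Icc, not_and_or, not_le] at hmem
    rcases hmem with h | h
    · linarith [neg_abs_le t]
    · linarith [le_abs_self t]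
  exact ht (by simp [Literature.Analysis.Calculus.cutoff_eq_zero hta])

/-- Pointwise: `‖φ_a t‖ = ‖Φ t‖ · χ_a t`. [folklore] -/
theorem norm_phiCut (a t : ℝ) :
    ‖(2 : ℂ) * LagariasMontague.Psic (2 * t) * ((Literature.Analysis.Calculus.cutoff a t : ℝ) : ℂ)‖ =
      ‖(2 : ℂ) * LagariasMontague.Psic (2 * t)‖ * Literature.Analysis.Calculus.cutoff a t := by
  rw [norm_mul, Complex.norm_real, Real.norm_eq_abs,
    abs_of_nonneg (Literature.Analysis.Calculus.cutoff_nonneg a t)]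

/-! ## The tail `h_a = Φ (1 - χ_a)`: derivatives, envelope bounds, strip decay of its transform -/

/-- **Derivatives and envelope bounds of the tail `h_a = Φ(1 − χ_a)`, uniform in `a`.** There are
constants `K₀, K₁, K₂ ≥ 0` such that for every `a` the tail has explicit first and second
derivatives `h_a' = Φ'(1−χ_a) − Φχ_a'`, `h_a'' = Φ''(1−χ_a) − 2Φ'χ_a' − Φχ_a''`, all three are
continuous and dominated by `K_j · exp(|t|/2 − (π/4)e^{2|t|})`, and `h_a = h_a'' = 0` on the open
plateau `|t| < a − 1`. [folklore] -/
theorem exists_tail_derivs :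
    ∃ K₀ K₁ K₂ : ℝ, 0 ≤ K₀ ∧ 0 ≤ K₁ ∧ 0 ≤ K₂ ∧ ∀ a : ℝ, ∃ h' h'' : ℝ → ℂ,
      (∀ t, HasDerivAt (fun t : ℝ => (2 : ℂ) * LagariasMontague.Psic (2 * t) *
        ((1 - Literature.Analysis.Calculus.cutoff a t : ℝ) : ℂ)) (h' t) t) ∧
      (∀ t, HasDerivAt h' (h'' t) t) ∧
      Continuous (fun t : ℝ => (2 : ℂ) * LagariasMontague.Psic (2 * t) *
        ((1 - Literature.Analysis.Calculus.cutoff a t : ℝ) : ℂ)) ∧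
      Continuous h' ∧ Continuous h'' ∧
      (∀ t, ‖(2 : ℂ) * LagariasMontague.Psic (2 * t) *
        ((1 - Literature.Analysis.Calculus.cutoff a t : ℝ) : ℂ)‖ ≤
          K₀ * Real.exp (|t| / 2 - π / 4 * Real.exp (2 * |t|))) ∧
      (∀ t, ‖h' t‖ ≤ K₁ * Real.exp (|t| / 2 - π / 4 * Real.exp (2 * |t|))) ∧
      (∀ t, ‖h'' t‖ ≤ K₂ * Real.exp (|t| / 2 - π / 4 * Real.exp (2 * |t|))) ∧
      (∀ t, |t| < a - 1 → (2 : ℂ) * LagariasMontague.Psic (2 * t) *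
        ((1 - Literature.Analysis.Calculus.cutoff a t : ℝ) : ℂ) = 0 ∧ h'' t = 0) := by
  obtain ⟨C₀, hC₀, hΦ⟩ := exists_norm_phi_le
  obtain ⟨C₁, hC₁, hΦ'⟩ := exists_norm_dphi_le
  obtain ⟨C₂, hC₂, hΦ''⟩ := exists_norm_ddphi_le
  obtain ⟨M, hM, hχ⟩ := exists_cutoff_deriv_bounds
  refine ⟨C₀, C₁ + C₀ * M, C₂ + 2 * (C₁ * M) + C₀ * M, hC₀, by positivity, by positivity, fun a => ?_⟩
  -- notation
  set Φ : ℝ → ℂ := fun t => (2 : ℂ) * LagariasMontague.Psic (2 * t) with hΦdef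
  set Φ' : ℝ → ℂ := fun t => (4 : ℂ) *
    (LagariasMontague.thetaSeries (LagariasMontague.thetaδ LagariasMontague.psiPoly) (2 * t) : ℂ) with hΦ'def
  set Φ'' : ℝ → ℂ := fun t => (8 : ℂ) * (LagariasMontague.thetaSeries
    (LagariasMontague.thetaδ (LagariasMontague.thetaδ LagariasMontague.psiPoly)) (2 * t) : ℂ) with hΦ''def
  set w : ℝ → ℂ := fun t => ((1 - Literature.Analysis.Calculus.cutoff a t : ℝ) : ℂ) with hwdef
  set w' : ℝ → ℂ := fun t => ((-deriv (Literature.Analysis.Calculus.cutoff a) t : ℝ) : ℂ) with hw'def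
  set w'' : ℝ → ℂ := fun t => ((-deriv (deriv (Literature.Analysis.Calculus.cutoff a)) t : ℝ) : ℂ) with hw''def
  set E : ℝ → ℝ := fun t => Real.exp (|t| / 2 - π / 4 * Real.exp (2 * |t|)) with hEdef
  have hχd : Differentiable ℝ (Literature.Analysis.Calculus.cutoff a) := (Literature.Analysis.Calculus.contDiff_cutoff a (n := 1)).differentiable (by norm_num)
  -- derivatives of the weights
  have hw : ∀ t, HasDerivAt w (w' t) t := fun t => by
    have h := ((hχd t).hasDerivAt.const_sub (1 : ℝ)).ofReal_comp
    simpa [hwdef, hw'def] using h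
  have hw' : ∀ t, HasDerivAt w' (w'' t) t := fun t => by
    have hd : HasDerivAt (deriv (Literature.Analysis.Calculus.cutoff a))
        (deriv (deriv (Literature.Analysis.Calculus.cutoff a)) t) t :=
      (hasDerivAt_deriv_cutoff a t).differentiableAt.hasDerivAt
    have h := hd.neg.ofReal_comp
    simpa [hw'def, hw''def] using h
  -- the derivative functions
  refine ⟨fun t => Φ' t * w t + Φ t * w' t, fun t => Φ'' t * w t + 2 * (Φ' t * w' t) + Φ t * w'' t,
    fun t => ?_, fun t => ?_, ?_, ?_, ?_, fun t => ?_, fun t => ?_, fun t => ?_, fun t ht => ?_⟩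
  · -- h' 
    have h := (phi_hasDerivAt t).mul (hw t)
    exact h.congr_deriv (by simp only [hΦ'def]; ring)
  · -- h''
    have h1 := (dphi_hasDerivAt t).mul (hw t)
    have h2 := (phi_hasDerivAt t).mul (hw' t)
    have h := h1.add h2
    refine h.congr_deriv ?_
    simp only [hΦ''def, hΦ'def, hΦdef]
    ring
  · exact continuous_phi.mul (Complex.continuous_ofReal.comp
      (continuous_const.sub (Literature.Analysis.Calculus.contDiff_cutoff a (n := 0)).continuous))
  · refine ((continuous_const.mul (Complex.continuous_ofReal.comp
      ((LagariasMontague.continuous_thetaSeries _).comp (continuous_const.mul continuous_id)))).mul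
      (Complex.continuous_ofReal.comp (continuous_const.sub
        (Literature.Analysis.Calculus.contDiff_cutoff a (n := 0)).continuous))).add
      (continuous_phi.mul (Complex.continuous_ofReal.comp (continuous_deriv_cutoff a).neg))
  · refine (((continuous_const.mul (Complex.continuous_ofReal.comp
      ((LagariasMontague.continuous_thetaSeries _).comp (continuous_const.mul continuous_id)))).mul
      (Complex.continuous_ofReal.comp (continuous_const.sub
        (Literature.Analysis.Calculus.contDiff_cutoff a (n := 0)).continuous))).add
      (continuous_const.mul ((continuous_const.mul (Complex.continuous_ofReal.comp
      ((LagariasMontague.continuous_thetaSeries _).comp (continuous_const.mul continuous_id)))).mul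
        (Complex.continuous_ofReal.comp (continuous_deriv_cutoff a).neg)))).add
      (continuous_phi.mul (Complex.continuous_ofReal.comp (continuous_deriv_deriv_cutoff a).neg))
  · -- ‖h‖ ≤ C₀ E
    have hw1 : ‖w t‖ ≤ 1 := by
      simp only [hwdef, Complex.norm_real, Real.norm_eq_abs]
      rw [abs_of_nonneg (sub_nonneg.2 (Literature.Analysis.Calculus.cutoff_le_one a t))]
      linarith [Literature.Analysis.Calculus.cutoff_nonneg a t]
    calc ‖Φ t * w t‖ = ‖Φ t‖ * ‖w t‖ := norm_mul _ _
      _ ≤ C₀ * E t * 1 := mul_le_mul (hΦ t) hw1 (norm_nonneg _) (by positivity)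
      _ = C₀ * E t := mul_one _
  · -- ‖h'‖ ≤ K₁ E
    have hw1 : ‖w t‖ ≤ 1 := by
      simp only [hwdef, Complex.norm_real, Real.norm_eq_abs]
      rw [abs_of_nonneg (sub_nonneg.2 (Literature.Analysis.Calculus.cutoff_le_one a t))]
      linarith [Literature.Analysis.Calculus.cutoff_nonneg a t]
    have hw2 : ‖w' t‖ ≤ M := by
      simp only [hw'def, Complex.norm_real, Real.norm_eq_abs, abs_neg]
      exact (hχ a t).1
    calc ‖Φ' t * w t + Φ t * w' t‖ ≤ ‖Φ' t‖ * ‖w t‖ + ‖Φ t‖ * ‖w' t‖ :=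
          (norm_add_le _ _).trans (le_of_eq (by simp only [norm_mul]))
      _ ≤ C₁ * E t * 1 + C₀ * E t * M :=
          add_le_add (mul_le_mul (hΦ' t) hw1 (norm_nonneg _) (by positivity))
            (mul_le_mul (hΦ t) hw2 (norm_nonneg _) (by positivity))
      _ = (C₁ + C₀ * M) * E t := by ring
  · -- ‖h''‖ ≤ K₂ E
    have hw1 : ‖w t‖ ≤ 1 := by
      simp only [hwdef, Complex.norm_real, Real.norm_eq_abs]
      rw [abs_of_nonneg (sub_nonneg.2 (Literature.Analysis.Calculus.cutoff_le_one a t))]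
      linarith [Literature.Analysis.Calculus.cutoff_nonneg a t]
    have hw2 : ‖w' t‖ ≤ M := by
      simp only [hw'def, Complex.norm_real, Real.norm_eq_abs, abs_neg]
      exact (hχ a t).1
    have hw3 : ‖w'' t‖ ≤ M := by
      simp only [hw''def, Complex.norm_real, Real.norm_eq_abs, abs_neg]
      exact (hχ a t).2.1
    calc ‖Φ'' t * w t + 2 * (Φ' t * w' t) + Φ t * w'' t‖
        ≤ ‖Φ'' t‖ * ‖w t‖ + 2 * (‖Φ' t‖ * ‖w' t‖) + ‖Φ t‖ * ‖w'' t‖ := by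
          refine (norm_add_le _ _).trans (add_le_add ((norm_add_le _ _).trans (add_le_add ?_ ?_)) ?_)
          · exact le_of_eq (norm_mul _ _)
          · rw [norm_mul, Complex.norm_ofNat, norm_mul]
          · exact le_of_eq (norm_mul _ _)
      _ ≤ C₂ * E t * 1 + 2 * (C₁ * E t * M) + C₀ * E t * M := by
          refine add_le_add (add_le_add (mul_le_mul (hΦ'' t) hw1 (norm_nonneg _) (by positivity))
            (mul_le_mul_of_nonneg_left (mul_le_mul (hΦ' t) hw2 (norm_nonneg _) (by positivity))
              zero_le_two)) (mul_le_mul (hΦ t) hw3 (norm_nonneg _) (by positivity))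
      _ = (C₂ + 2 * (C₁ * M) + C₀ * M) * E t := by ring
  · -- vanishing on the plateau
    have h1 : Literature.Analysis.Calculus.cutoff a t = 1 := Literature.Analysis.Calculus.cutoff_eq_one ht.le
    have h2 := (hχ a t).2.2 ht
    refine ⟨?_, ?_⟩
    · simp [h1]
    · simp [hwdef, hw'def, hw''def, h1, h2.1, h2.2]

/-- **Strip decay of the transform of the tail, uniformly in `a ≥ 1`**: there is `D ≥ 0` with
`‖(Φ(1−χ_a))^(s)‖ ≤ D · exp(−(π/4)e^{2(a−1)}) / (1 + (Im s)²)` for `0 ≤ Re s ≤ 1`. [folklore] -/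
theorem exists_norm_weilMellin_tail_le :
    ∃ D : ℝ, 0 ≤ D ∧ ∀ a : ℝ, 1 ≤ a → ∀ s : ℂ, 0 ≤ s.re → s.re ≤ 1 →
      ‖weilMellin (fun t : ℝ => (2 : ℂ) * LagariasMontague.Psic (2 * t) *
          ((1 - Literature.Analysis.Calculus.cutoff a t : ℝ) : ℂ)) s‖ ≤
        D * Real.exp (-(π / 4 * Real.exp (2 * (a - 1)))) / (1 + s.im ^ 2) := by
  obtain ⟨K₀, K₁, K₂, hK₀, hK₁, hK₂, hall⟩ := exists_tail_derivs
  refine ⟨2 * ((K₀ + K₂) * (4 / π)), by positivity, fun a ha s hs0 hs1 => ?_⟩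
  obtain ⟨h', h'', hd, hd', hc, hc', hc'', hb, hb', hb'', hvan⟩ := hall a
  have hA : 0 ≤ a - 1 := by linarith
  have hcre : |(s - 1 / 2).re| ≤ 1 / 2 := by
    rw [abs_le]; constructor <;> · simp; linarith
  obtain ⟨hi0, hI0⟩ := integral_norm_mul_exp_half_le_of_envelope hc hK₀ hA hb (fun t ht => (hvan t ht).1)
  obtain ⟨hi2, hI2⟩ := integral_norm_mul_exp_half_le_of_envelope hc'' hK₂ hA hb'' (fun t ht => (hvan t ht).2)
  have key := norm_weilMellin_le_of_two_derivs hs0 hs1 hd hd'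
    (integrable_mul_cexp_of_envelope hc hb hcre) (integrable_mul_cexp_of_envelope hc' hb' hcre)
    (integrable_mul_cexp_of_envelope hc'' hb'' hcre) hi0 hi2 hI0 hI2
  refine key.trans (le_of_eq ?_)
  rw [show 2 * (a - 1) = 2 * (a - 1) by rfl]
  ring

/-- **The transform of `φ_a` in the closed strip is `ξ` minus the tail transform**:
`φ̂_a(s) = ξ(s) − (Φ(1−χ_a))^(s)` (`Φ̂ = ξ`, `stub_mellinXi`; additivity of the integral). [folklore] -/
theorem weilMellin_phiCut_eq (a : ℝ) {s : ℂ} (hs0 : 0 ≤ s.re) (hs1 : s.re ≤ 1) :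
    weilMellin (fun t : ℝ => (2 : ℂ) * LagariasMontague.Psic (2 * t) *
        ((Literature.Analysis.Calculus.cutoff a t : ℝ) : ℂ)) s =
      riemannXi s - weilMellin (fun t : ℝ => (2 : ℂ) * LagariasMontague.Psic (2 * t) *
        ((1 - Literature.Analysis.Calculus.cutoff a t : ℝ) : ℂ)) s := by
  obtain ⟨K₀, K₁, K₂, hK₀, -, -, hall⟩ := exists_tail_derivs
  obtain ⟨h', h'', -, -, hc, -, -, hb, -, -, -⟩ := hall a
  have hcre : |(s - 1 / 2).re| ≤ 1 / 2 := by
    rw [abs_le]; constructor <;> · simp; linarith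
  have hξ : riemannXi s = weilMellin (fun t : ℝ => (2 : ℂ) * LagariasMontague.Psic (2 * t)) s :=
    (stub_mellinXi stub_psiDecay.1 stub_psiDecay.2 s).symm
  have hφ := isWeilTest_phiCut a
  have hi1 : Integrable fun t : ℝ => (2 : ℂ) * LagariasMontague.Psic (2 * t) *
      ((Literature.Analysis.Calculus.cutoff a t : ℝ) : ℂ) * cexp ((s - 1 / 2) * t) :=
    integrable_weilIntegrand hφ.1.continuous hφ.2 s
  have hi2 : Integrable fun t : ℝ => (2 : ℂ) * LagariasMontague.Psic (2 * t) *
      ((1 - Literature.Analysis.Calculus.cutoff a t : ℝ) : ℂ) * cexp ((s - 1 / 2) * t) :=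
    integrable_mul_cexp_of_envelope hc hb hcre
  rw [hξ, eq_sub_iff_add_eq]
  unfold weilMellin
  rw [← integral_add hi1 hi2]
  refine integral_congr_ae (ae_of_all _ fun t => ?_)
  push_cast
  ring

/-- **At a non-trivial zero `ρ` (where `ξ(ρ) = 0`), `φ̂_a(ρ)` IS the (tiny) tail transform**:
`‖φ̂_a(ρ)‖ ≤ D exp(−(π/4)e^{2(a−1)})/(1 + γ²)` for `a ≥ 1`, uniformly. [folklore] -/
theorem exists_norm_weilMellin_phiCut_zero_le :
    ∃ D : ℝ, 0 ≤ D ∧ ∀ a : ℝ, 1 ≤ a → ∀ ρ : ℂ, ρ ∈ ZetaZeros.riemannZetaNontrivialZeros →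
      ‖weilMellin (fun t : ℝ => (2 : ℂ) * LagariasMontague.Psic (2 * t) *
          ((Literature.Analysis.Calculus.cutoff a t : ℝ) : ℂ)) ρ‖ ≤
        D * Real.exp (-(π / 4 * Real.exp (2 * (a - 1)))) / (1 + ρ.im ^ 2) := by
  obtain ⟨D, hD, hT⟩ := exists_norm_weilMellin_tail_le
  refine ⟨D, hD, fun a ha ρ hρ => ?_⟩
  have h0 := ZetaZeros.riemannZetaNontrivialZeros.re_pos hρ
  have h1 := ZetaZeros.riemannZetaNontrivialZeros.re_lt_one hρ
  rw [weilMellin_phiCut_eq a h0.le h1.le, riemannXi_eq_zero_of_mem_riemannZetaNontrivialZeros hρ,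
    zero_sub, norm_neg]
  exact hT a ha ρ h0.le h1.le


end Summit.RiemannHypothesis.RiemannHypothesis.Theorems.GroundStatesConvergeToXi

end
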